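import Mathlib.Tactic.IntervalCases
import Literature.Topology.FourManifolds.HomotopySpheresBP
import Literature.Topology.FourManifolds.Parallelizable
import Literature.Topology.FourManifolds.SpinSphereStableProofs
import Literature.Topology.FourManifolds.HomotopySpheresGroupDimOne
import Literature.Topology.FourManifolds.SmoothPoincareLowDim
import HarnessLib

/-!
# Kervaire–Milnor's Theorem 3.1 for standard homotopy spheres and in low dimensions

Trunk T-4MAN (`Literature/Topology/FourManifolds`). Sibling proofs file of
`HomotopySpheresBP.lean` (the named fact
`Literature.Topology.FourManifolds.HomotopySphere.isStablyParallelizable`: Kervaire–Milnor,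
*Groups of homotopy spheres I*, Ann. of Math. 77 (1963), Thm. 3.1, p. 508, "Every homotopy sphere
is s-parallelizable") and of `HomotopySpheresStablyParallelizable.lean` (the case `n = 7` from two
finer named facts, by clutching). This file records, **sorry-free and unconditionally where the
tree allows it**, the instances of Thm. 3.1 that do not need the obstruction theory of the printed
proof:

* `Literature.Topology.FourManifolds.HomotopySphere.isStablyParallelizable_of_nonempty_diffeomorph_sphere`
  (**proved**): a homotopy `n`-sphere diffeomorphic to `𝕊ⁿ` is s-parallelizable — `𝕊ⁿ` is
  (`isStablyParallelizable_sphere_holds`, `SpinSphereStableProofs.lean`: `τ(𝕊ⁿ) ⊕ ν = εⁿ⁺¹`) and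
  stable parallelizability is a diffeomorphism invariant
  (`IsStablyParallelizable.of_diffeomorph`, `Parallelizable.lean`). Variant consuming Mathlib's
  `ContinuousMap.HomotopyEquiv.NonemptyDiffeomorphSphere` (the smooth Poincaré statement in
  dimension `n` for the carrier): `isStablyParallelizable_of_nonemptyDiffeomorphSphere`.
* `Literature.Topology.FourManifolds.HomotopySphere.isStablyParallelizable_zero`,
  `Literature.Topology.FourManifolds.HomotopySphere.isStablyParallelizable_one`,
  `Literature.Topology.FourManifolds.HomotopySphere.isStablyParallelizable_of_le_one` (**proved,
  unconditional**): Thm. 3.1 in dimensions `0` (rank-`0` tangent bundle) and `1` (`Θ₁ = 0`: every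
  homotopy `1`-sphere is a circle, `HomotopySphere.nonempty_diffeomorph_sphere_one`,
  `HomotopySpheresGroupDimOne.lean` / `OneManifoldCircle.lean`). Kervaire–Milnor's printed proof
  starts at `n ≥ 2` (Bott's table, p. 508); accordingly
  `Literature.Topology.FourManifolds.HomotopySphere.isStablyParallelizable_of_two_le` (**proved**)
  reduces the named fact to the dimensions `n ≥ 2`.
* `Literature.Topology.FourManifolds.HomotopySphere.isStablyParallelizable_two_of`,
  `…_three_of`, `…_of_le_three_of`, `…_of_mem_of` (**proved from existing named facts**): Thm. 3.1
  in dimension `2` from the classification of surfaces (`nonemptyDiffeomorphSphere_two`,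
  `SmoothPoincareLowDim.lean`; Kervaire–Milnor p. 507, `Θ₂ = 0`), in dimension `3` from
  Perelman's theorem (`nonempty_diffeomorph_sphere_three`, spc4.S31), and in the dimensions
  `n ∈ {1, 2, 3, 5, 6, 12, 56, 61}` in which the smooth Poincaré conjecture is known
  (`nonemptyDiffeomorphSphere_of_mem`, spc4.S32).

## What is NOT here

The named fact itself (all `n`) is not discharged. Its printed proof (pp. 508–509) needs, beyond
the standard spheres: obstruction theory for the stable tangent bundle with coefficients
`πₙ₋₁(SO)`; Bott periodicity (Case 1, `n ≡ 3, 5, 6, 7 (mod 8)`; the tree vendors only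
`π₆(SO(8)) = 0`, `Bott1959_sphereMapsToStableFramesExtend_six`, for the `Θ₇` cone); Pontryagin
classes and the Hirzebruch signature theorem (Case 2, `n ≡ 0, 4 (mod 8)`); Rohlin's
`Jₙ₋₁ ∘ oₙ = 0` and Adams' injectivity of `Jₙ₋₁` (Case 3, `n ≡ 1, 2 (mod 8)`). None of these is
in Mathlib or in the tree. Dimension `4` in particular is *not* an instance of the results below
(whether every homotopy `4`-sphere is diffeomorphic to `𝕊⁴` is the smooth Poincaré conjecture in
dimension `4`); Kervaire–Milnor obtain it from the signature theorem.

Design: theorems only (no definitions, notation or instances); `𝕊ⁿ` is written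
`Metric.sphere (0 : EuclideanSpace ℝ (Fin (n + 1))) 1` in the statements.

## References

* M. Kervaire, J. Milnor, *Groups of homotopy spheres I*, Ann. of Math. 77 (1963), 504–537: §3,
  Thm. 3.1 and its proof (p. 508: definition of s-parallelizable, Bott's table "for `n ≥ 2`",
  Cases 1–3); §2, p. 507 ("Clearly `Θ₁` is zero … It follows that `Θ₂ = 0`. If the Poincaré
  hypothesis were proved, it would follow that `Θ₃` is zero"). [KervaireMilnorAnnals1963]
* A. Kosinski, *Differential Manifolds* (1993), Ch. IX §7, Def. 7.1 and remark p. 187 (spheres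
  are π-manifolds); Ch. IX Cor. (8.6) ("Homotopy spheres are π-manifolds"). [Kosinski1993]
* M. W. Hirsch, *Differential Topology* (1976), Ch. 4 §1, p. 88 (`Tf` is a bundle equivalence
  for a diffeomorphism `f`). [HirschDT1976]
* J. Morgan, G. Tian, *Ricci flow and the Poincaré conjecture* (2007), Cor. 0.2 (a).
  [MorganTian2007]
-/

open scoped Manifold ContDiff Topology
open Set Function Module

namespace Literature.Topology.FourManifolds

namespace HomotopySphere

variable {n : ℕ}

/-! ### Standard homotopy spheres are s-parallelizable -/

/-- **A homotopy sphere diffeomorphic to the standard sphere is s-parallelizable** — the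
instance `Σ ≅ 𝕊ⁿ` of Kervaire–Milnor's Thm. 3.1 ("Every homotopy sphere is s-parallelizable",
*Groups of homotopy spheres I* (1963), p. 508): `T𝕊ⁿ ⊕ ℝ` is trivial
(`isStablyParallelizable_sphere_holds`; Kosinski, *Differential Manifolds*, IX §7, remark after
Def. 7.1: "Obvious examples of π-manifolds are provided by spheres of all dimensions") and a
diffeomorphism `φ : Σ ≅ 𝕊ⁿ` transports stable framings (`IsStablyParallelizable.of_diffeomorph`
applied to `φ⁻¹`; Hirsch, *Differential Topology*, Ch. 4 §1, p. 88). The orientation of `Σ` plays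
no role. [cite: KervaireMilnorAnnals1963, §3, Thm. 3.1 (p. 508), instance Σ ≅ Sⁿ] -/
theorem isStablyParallelizable_of_nonempty_diffeomorph_sphere (S : HomotopySphere n)
    (h : Nonempty (S.carrier ≃ₘ⟮𝓡 n, 𝓡 n⟯ (Metric.sphere (0 : EuclideanSpace ℝ (Fin (n + 1))) 1))) :
    IsStablyParallelizable (𝓡 n) S.carrier := by
  obtain ⟨φ⟩ := h
  have h0 : (∞ : WithTop ℕ∞) ≠ 0 := by simp
  exact (isStablyParallelizable_sphere_holds n).of_diffeomorph φ.symm h0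

/-- **Thm. 3.1 for a homotopy sphere whose carrier satisfies the smooth Poincaré statement in
its dimension** (Mathlib's `ContinuousMap.HomotopyEquiv.NonemptyDiffeomorphSphere M n`: every
smooth structure on `M` homotopy equivalent to `𝕊ⁿ` is diffeomorphic to `𝕊ⁿ`): feed the homotopy
equivalence `Σ ≃ₕ 𝕊ⁿ` carried by `Σ` to it and apply
`isStablyParallelizable_of_nonempty_diffeomorph_sphere`. This is the form in which the tree's
low-dimensional facts (`nonemptyDiffeomorphSphere_two`, `nonemptyDiffeomorphSphere_of_mem`, …) are
consumed below (Kervaire–Milnor 1963, p. 507: `Θ₁ = Θ₂ = 0`, and `Θ₃ = 0` under the Poincaré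
hypothesis). [cite: KervaireMilnorAnnals1963, §3, Thm. 3.1 (p. 508) with §2 p. 507] -/
theorem isStablyParallelizable_of_nonemptyDiffeomorphSphere (S : HomotopySphere n)
    (h : ContinuousMap.HomotopyEquiv.NonemptyDiffeomorphSphere S.carrier n) :
    IsStablyParallelizable (𝓡 n) S.carrier := by
  obtain ⟨e⟩ := S.nonempty_homotopyEquiv
  exact S.isStablyParallelizable_of_nonempty_diffeomorph_sphere (h S.chartedSpace S.isManifold e)

/-- **The standard homotopy sphere `(𝕊ⁿ, o)` is s-parallelizable**, for every orientation `o`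
(`HomotopySphere.sphere o`, the zero of `Θₙ`): its carrier is `𝕊ⁿ`
(`isStablyParallelizable_sphere_holds`; Kervaire–Milnor 1963, §3; Kosinski IX §7, p. 187).
[cite: Kosinski1993, Ch. IX §7, Def. 7.1 and remark p. 187] -/
theorem isStablyParallelizable_sphere
    (o : SmoothOrientation (𝓡 n) (Metric.sphere (0 : EuclideanSpace ℝ (Fin (n + 1))) 1)) :
    IsStablyParallelizable (𝓡 n) (HomotopySphere.sphere o).carrier :=
  isStablyParallelizable_sphere_holds n

/-! ### Dimensions `0` and `1`: unconditional -/

/-- **Thm. 3.1 in dimension `0`**: a homotopy `0`-sphere (a compact `0`-manifold homotopy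
equivalent to `𝕊⁰`) is s-parallelizable — its tangent bundle has rank `finrank ℝ ℝ⁰ = 0`, so it
is (vacuously) parallelizable (`isParallelizable_of_finrank_eq_zero`) and hence stably
parallelizable (`IsParallelizable.isStablyParallelizable`: the framing of `TΣ ⊕ ℝ` is the single
section `(0, 1)`). Degenerate case, below the range `n ≥ 2` of the printed proof
(Kervaire–Milnor 1963, p. 508). [folklore] -/
theorem isStablyParallelizable_zero (S : HomotopySphere 0) :
    IsStablyParallelizable (𝓡 0) S.carrier :=
  (isParallelizable_of_finrank_eq_zero (I := 𝓡 0) (M := S.carrier) (by simp)).isStablyParallelizable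

/-- **Thm. 3.1 in dimension `1`, unconditionally**: every homotopy `1`-sphere is s-parallelizable.
A homotopy `1`-sphere is diffeomorphic to the circle `𝕊¹`
(`HomotopySphere.nonempty_diffeomorph_sphere_one`: a compact connected oriented `1`-manifold is
a circle, Milnor 1965, Appendix; Kervaire–Milnor 1963, p. 507: "Clearly `Θ₁` is zero"), and
`𝕊¹` is s-parallelizable (`isStablyParallelizable_of_nonempty_diffeomorph_sphere`).
[cite: KervaireMilnorAnnals1963, §3, Thm. 3.1 (p. 508), n = 1 via §2 p. 507 (Θ₁ = 0)] -/
theorem isStablyParallelizable_one (S : HomotopySphere 1) :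
    IsStablyParallelizable (𝓡 1) S.carrier :=
  S.isStablyParallelizable_of_nonempty_diffeomorph_sphere S.nonempty_diffeomorph_sphere_one

/-- **Thm. 3.1 in dimensions `n ≤ 1`, unconditionally** (`isStablyParallelizable_zero`,
`isStablyParallelizable_one`). [cite: KervaireMilnorAnnals1963, §3, Thm. 3.1 (p. 508), n ≤ 1] -/
theorem isStablyParallelizable_of_le_one (hn : n ≤ 1) (S : HomotopySphere n) :
    IsStablyParallelizable (𝓡 n) S.carrier := by
  interval_cases n
  · exact S.isStablyParallelizable_zero
  · exact S.isStablyParallelizable_one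

/-- **The named fact `HomotopySphere.isStablyParallelizable` reduces to dimensions `n ≥ 2`**:
Kervaire–Milnor's proof of Thm. 3.1 (p. 508: "these stable groups have been computed by Bott, as
follows, for `n ≥ 2`") treats `n ≥ 2`; the dimensions `0` and `1` are the unconditional theorems
`isStablyParallelizable_zero` and `isStablyParallelizable_one`. So it suffices to establish the
statement for homotopy spheres of dimension at least `2`.
[cite: KervaireMilnorAnnals1963, §3, proof of Thm. 3.1, p. 508 ("for n ≥ 2")] -/
theorem isStablyParallelizable_of_two_le
    (h : ∀ n : ℕ, 2 ≤ n → ∀ S : HomotopySphere n, IsStablyParallelizable (𝓡 n) S.carrier) :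
    isStablyParallelizable := by
  intro n S
  rcases Nat.lt_or_ge n 2 with hn | hn
  · exact isStablyParallelizable_of_le_one (by omega) S
  · exact h n hn S

/-! ### Dimensions `2`, `3` and the smooth-Poincaré dimensions, from the tree's named facts -/

/-- **Thm. 3.1 in dimension `2`, from the classification of surfaces**: given the smooth
Poincaré statement in dimension `2` (`nonemptyDiffeomorphSphere_two`, `SmoothPoincareLowDim.lean`;
Kervaire–Milnor 1963, p. 507: "It follows that `Θ₂ = 0`"), every homotopy `2`-sphere is
diffeomorphic to `𝕊²`, hence s-parallelizable. (Kervaire–Milnor's own argument for `n = 2` is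
Case 3 of p. 509: `π₁(SO) = ℤ₂` and `J₁` is injective.)
[cite: KervaireMilnorAnnals1963, §3, Thm. 3.1 (p. 508), n = 2 via §2 p. 507 (Θ₂ = 0)] -/
theorem isStablyParallelizable_two_of (h2 : nonemptyDiffeomorphSphere_two.{0})
    (S : HomotopySphere 2) : IsStablyParallelizable (𝓡 2) S.carrier :=
  S.isStablyParallelizable_of_nonemptyDiffeomorphSphere (h2 S.carrier)

/-- **Thm. 3.1 in dimension `3`, from Perelman's theorem**: given the smooth Poincaré conjecture
in dimension `3` as vendored in the tree (`nonempty_diffeomorph_sphere_three`, spc4.S31;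
Morgan–Tian 2007, Cor. 0.2 (a)), every homotopy `3`-sphere is diffeomorphic to `𝕊³`
(`nonemptyDiffeomorphSphere_three_of`), hence s-parallelizable. Kervaire–Milnor 1963, p. 507:
"If the Poincaré hypothesis were proved, it would follow that `Θ₃` is zero"; their own argument
for `n = 3` is Case 1 of p. 508 (`π₂(SO) = 0`).
[cite: KervaireMilnorAnnals1963, §3, Thm. 3.1 (p. 508), n = 3 via §2 p. 507] -/
theorem isStablyParallelizable_three_of (h3 : nonempty_diffeomorph_sphere_three.{0})
    (S : HomotopySphere 3) : IsStablyParallelizable (𝓡 3) S.carrier :=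
  S.isStablyParallelizable_of_nonemptyDiffeomorphSphere
    (nonemptyDiffeomorphSphere_three_of h3 S.carrier)

/-- **Thm. 3.1 in dimensions `n ≤ 3`**, from the classification of surfaces (`n = 2`,
`nonemptyDiffeomorphSphere_two`) and Perelman's theorem (`n = 3`,
`nonempty_diffeomorph_sphere_three`); dimensions `0`, `1` are unconditional
(`isStablyParallelizable_of_le_one`). Kervaire–Milnor 1963, Thm. 3.1 with p. 507.
[cite: KervaireMilnorAnnals1963, §3, Thm. 3.1 (p. 508), n ≤ 3 via §2 p. 507] -/
theorem isStablyParallelizable_of_le_three_of (h2 : nonemptyDiffeomorphSphere_two.{0})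
    (h3 : nonempty_diffeomorph_sphere_three.{0}) (hn : n ≤ 3) (S : HomotopySphere n) :
    IsStablyParallelizable (𝓡 n) S.carrier := by
  interval_cases n
  · exact S.isStablyParallelizable_zero
  · exact S.isStablyParallelizable_one
  · exact isStablyParallelizable_two_of h2 S
  · exact isStablyParallelizable_three_of h3 S

/-- **Thm. 3.1 in the dimensions where the smooth Poincaré conjecture is known**: given
spc4.S32 (`nonemptyDiffeomorphSphere_of_mem`: for `n ∈ {1, 2, 3, 5, 6, 12, 56, 61}` every smooth
manifold homotopy equivalent to `𝕊ⁿ` is diffeomorphic to it — `Θₙ = 0` in these dimensions,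
Kervaire–Milnor 1963 and Part II; Wang–Xu 2017 for `61`), every homotopy `n`-sphere in these
dimensions is standard, hence s-parallelizable
(`isStablyParallelizable_of_nonemptyDiffeomorphSphere`).
[cite: KervaireMilnorAnnals1963, §3, Thm. 3.1 (p. 508), instance Σ ≅ Sⁿ] -/
theorem isStablyParallelizable_of_mem_of (h : nonemptyDiffeomorphSphere_of_mem.{0})
    (hn : n ∈ ({1, 2, 3, 5, 6, 12, 56, 61} : Set ℕ)) (S : HomotopySphere n) :
    IsStablyParallelizable (𝓡 n) S.carrier :=
  S.isStablyParallelizable_of_nonemptyDiffeomorphSphere (h n hn S.carrier)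

end HomotopySphere

end Literature.Topology.FourManifolds
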